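import Literature.NumberTheory.LFunctions.DirichletXiPairZeros
import HarnessLib

/-!
# The pair `Ξ_χ = ξ(·,χ)ξ(·,χ̄)`: multiplicities in the Hadamard product

Topic `Literature/NumberTheory/LFunctions`, sub-namespace `DirichletTheta` (continuation of `DirichletXiPairHadamard.lean`,
`DirichletXiPairZeros.lean`; the `Ξ_χ`-twin of `IsHadamardSeq.analyticOrderAt_eq_mult` /
`natCast_card_zeroIndices_xiToH` of the `ζ` pipeline).  Everything here is PROVED; no definitions.  **RH-FREE, GRH-FREE.**

For a primitive `χ ≠ 1` and a Hadamard sequence `b` of `Ξ_χ` at the base point `9/4` (`exists_xiPair_hadamardSeq`: the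
non-zero `bₙ` are the inverses of the zeros of `w ↦ G_χ(w + 9/4)` counted with multiplicity, `G_χ(z²) = Ξ_χ(½ + z)`):

* `analyticOrderAt_dirichletXi_eq_zeroOrder` — `ord_ρ ξ(·,χ) = m_χ(ρ)` for `Re ρ > 0` (`m_χ = DirichletDisc.zeroOrder χ`, the
  multiplicity of `ρ` as a zero of `L(s,χ)`), hence `ord_ρ Ξ_χ = m_χ(ρ) + m_χ̄(ρ)` (`analyticOrderAt_xiPair_eq`);
* order transport along `z ↦ ½ + z` and along the square `z ↦ z²` (`ord_{z₁}(G_χ ∘ sq) = ord_{z₁²}(G_χ) · ord_{z₁}(z² − z₁²)`,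
  Mathlib's `AnalyticAt.analyticOrderAt_comp`; the second factor is `1` off the centre and `2` at `z₁ = 0`);
* **`ncard_index_add_ncard_index_eq`** — for every zero `ρ` of `Ξ_χ`, the number of Hadamard indices `k` with `ρₖ = ρ` plus
  the number with `1 − ρₖ = ρ` equals `m_χ(ρ) + m_χ̄(ρ)`.  Off the centre (`ρ ≠ ½`) the two index sets are disjoint and
  partition `{k : bₖ = 1/((ρ−½)² − 9/4)}`; AT the centre (`ρ = ½`, possible iff `L(½,χ)L(½,χ̄) = 0`, not excluded) they
  coincide, and the missing factor `2` is exactly the order of `z ↦ z²` at `0` — the even function `Ξ_χ(½ + z)` has even order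
  at `z = 0`.

This is the bookkeeping that turns sums over the Hadamard pairs `{ρₖ, 1−ρₖ}` into sums over the zeros of `L(s,χ)` and
`L(s,χ̄)` weighted by multiplicity (next file: the double counting into `LiDirichlet.liCoeffCharRe`).

## References
* J. B. Conway, *Functions of One Complex Variable I*, Ch. XI Thm. 3.4. [Conway1978]
* H. L. Montgomery, R. C. Vaughan, *Multiplicative Number Theory I*, Cor. 10.8, Thm. 14.5 (proof). [MontgomeryVaughan2007]
-/

noncomputable section

open Complex Filter Topology Set Metric
open scoped ComplexConjugate

namespace Literature.NumberTheory.LFunctions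

namespace DirichletTheta

variable {q : ℕ} [NeZero q] {χ : DirichletCharacter ℂ q} {b : ℕ → ℂ}

/-! ### Orders of `ξ(·,χ)` and `Ξ_χ` -/

/-- **`ord_ρ ξ(·, χ) = m_χ(ρ)`** for `Re ρ > 0` (`χ ≠ 1`): the prefactor `q^{(s+a)/2}` is zero-free and `Λ`, `L` have the
same order there. [cite: MontgomeryVaughan2007, Theorem 14.5 (proof)] -/
theorem analyticOrderAt_dirichletXi_eq_zeroOrder (h1 : χ ≠ 1) {ρ : ℂ} (h0 : 0 < ρ.re) :
    analyticOrderAt (dirichletXi χ) ρ = (DirichletDisc.zeroOrder χ ρ : ℕ∞) := by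
  have hq0 : (q : ℂ) ≠ 0 := by exact_mod_cast NeZero.ne q
  have hfun : dirichletXi χ =
      (fun s : ℂ ↦ (q : ℂ) ^ ((s + (charParity χ : ℂ)) / 2)) * DirichletCharacter.completedLFunction χ := by
    funext s; rfl
  have hdP : Differentiable ℂ (fun s : ℂ ↦ (q : ℂ) ^ ((s + (charParity χ : ℂ)) / 2)) := fun s ↦
    DifferentiableAt.const_cpow (by fun_prop) (Or.inl hq0)
  have hP : AnalyticAt ℂ (fun s : ℂ ↦ (q : ℂ) ^ ((s + (charParity χ : ℂ)) / 2)) ρ := hdP.analyticAt ρ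
  have hΛ : AnalyticAt ℂ (DirichletCharacter.completedLFunction χ) ρ :=
    (DirichletCharacter.differentiable_completedLFunction h1).analyticAt ρ
  have hP0 : analyticOrderAt (fun s : ℂ ↦ (q : ℂ) ^ ((s + (charParity χ : ℂ)) / 2)) ρ = 0 :=
    hP.analyticOrderAt_eq_zero.2 (by rw [Ne, cpow_eq_zero_iff, not_and_or]; exact Or.inl hq0)
  rw [hfun, analyticOrderAt_mul hP hΛ, hP0, zero_add, ← SiegelZero.analyticOrderAt_LFunction_eq_completed h1 h0,
    DirichletDisc.zeroOrder, Nat.cast_analyticOrderNatAt (DirichletDisc.analyticOrderAt_LFunction_ne_top χ h1 ρ)]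

/-- **`ord_ρ Ξ_χ = m_χ(ρ) + m_χ̄(ρ)`** for `Re ρ > 0` (`χ ≠ 1`). [cite: MontgomeryVaughan2007, Theorem 14.5 (proof)] -/
theorem analyticOrderAt_xiPair_eq (h1 : χ ≠ 1) {ρ : ℂ} (h0 : 0 < ρ.re) :
    analyticOrderAt (xiPair χ) ρ = ((DirichletDisc.zeroOrder χ ρ + DirichletDisc.zeroOrder χ⁻¹ ρ : ℕ) : ℕ∞) := by
  have hfun : xiPair χ = dirichletXi χ * dirichletXi χ⁻¹ := by funext s; rfl
  rw [hfun, analyticOrderAt_mul ((differentiable_dirichletXi h1).analyticAt ρ)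
    ((differentiable_dirichletXi (inv_ne_one.mpr h1)).analyticAt ρ),
    analyticOrderAt_dirichletXi_eq_zeroOrder h1 h0, analyticOrderAt_dirichletXi_eq_zeroOrder (inv_ne_one.mpr h1) h0,
    Nat.cast_add]

/-- A zero of `Ξ_χ` lies in the open critical strip (primitive `χ ≠ 1`). [cite: MontgomeryVaughan2007, Cor 10.8] -/
theorem re_mem_Ioo_of_xiPair_eq_zero (hχ : χ.IsPrimitive) (h1 : χ ≠ 1) {ρ : ℂ} (hρ : xiPair χ ρ = 0) :
    0 < ρ.re ∧ ρ.re < 1 := by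
  by_contra h
  have h' : ρ.re ≤ 0 ∨ 1 ≤ ρ.re := by
    rw [not_and_or, not_lt, not_lt] at h
    exact h
  have hinv : χ⁻¹.IsPrimitive := by
    rw [DirichletCharacter.isPrimitive_def, DirichletCharacter.conductor_inv]; exact hχ
  exact mul_ne_zero (dirichletXi_ne_zero_of_not_mem_strip hχ h1 h')
    (dirichletXi_ne_zero_of_not_mem_strip hinv (inv_ne_one.mpr h1) h') hρ

/-! ### Order transport: translation and the square map -/

/-- `ord_{z₁}(z ↦ Ξ_χ(½ + z)) = ord_{½ + z₁} Ξ_χ`. [folklore] -/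
private theorem analyticOrderAt_xiPair_half_add (χ : DirichletCharacter ℂ q) (z₁ : ℂ) :
    analyticOrderAt (fun z ↦ xiPair χ (1 / 2 + z)) z₁ = analyticOrderAt (xiPair χ) (1 / 2 + z₁) := by
  have hg : AnalyticAt ℂ (fun z : ℂ ↦ 1 / 2 + z) z₁ := analyticAt_const.add analyticAt_id
  have hg' : deriv (fun z : ℂ ↦ 1 / 2 + z) z₁ ≠ 0 := by
    rw [deriv_const_add, deriv_id'']; exact one_ne_zero
  have h := analyticOrderAt_comp_of_deriv_ne_zero (f := xiPair χ) hg hg'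
  exact h

/-- `ord_a (w ↦ G_χ(w + 9/4)) = ord_{a + 9/4} G_χ`. [folklore] -/
private theorem analyticOrderAt_xiPairLift_shift (a : ℂ) :
    analyticOrderAt (fun w ↦ xiPairLift χ (w + 9 / 4)) a = analyticOrderAt (xiPairLift χ) (a + 9 / 4) := by
  have hg : AnalyticAt ℂ (fun w : ℂ ↦ w + 9 / 4) a := analyticAt_id.add analyticAt_const
  have hg' : deriv (fun w : ℂ ↦ w + 9 / 4) a ≠ 0 := by
    rw [deriv_add_const, deriv_id'']; exact one_ne_zero
  exact analyticOrderAt_comp_of_deriv_ne_zero (f := xiPairLift χ) hg hg'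

/-- **Order transport along the square**: `ord_{z₁}(z ↦ Ξ_χ(½+z)) = ord_{z₁²}(G_χ) · ord_{z₁}(z² − z₁²)`
(`Ξ_χ(½ + z) = G_χ(z²)`). [folklore] -/
private theorem analyticOrderAt_half_add_eq_mul (hχ : χ.IsPrimitive) (h1 : χ ≠ 1) (z₁ : ℂ) :
    analyticOrderAt (fun z ↦ xiPair χ (1 / 2 + z)) z₁ =
      analyticOrderAt (xiPairLift χ) (z₁ ^ 2) * analyticOrderAt (fun z : ℂ ↦ z ^ 2 - z₁ ^ 2) z₁ := by
  have hfun : (fun z ↦ xiPair χ (1 / 2 + z)) = xiPairLift χ ∘ fun z : ℂ ↦ z ^ 2 := by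
    funext z; exact (xiPairLift_sq hχ h1 z).symm
  have hf : AnalyticAt ℂ (xiPairLift χ) ((fun z : ℂ ↦ z ^ 2) z₁) :=
    (differentiable_xiPairLift hχ h1).analyticAt _
  have hg : AnalyticAt ℂ (fun z : ℂ ↦ z ^ 2) z₁ := analyticAt_id.pow 2
  rw [hfun, hf.analyticOrderAt_comp hg]

/-- `ord_{z₁}(z² − z₁²) = 1` for `z₁ ≠ 0`. [folklore] -/
private theorem analyticOrderAt_sq_sub_sq_of_ne_zero {z₁ : ℂ} (hz : z₁ ≠ 0) :
    analyticOrderAt (fun z : ℂ ↦ z ^ 2 - z₁ ^ 2) z₁ = 1 := by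
  have hg : AnalyticAt ℂ (fun z : ℂ ↦ z ^ 2) z₁ := analyticAt_id.pow 2
  have hg' : deriv (fun z : ℂ ↦ z ^ 2) z₁ ≠ 0 := by
    rw [deriv_pow_field]; simpa using hz
  exact hg.analyticOrderAt_sub_eq_one_of_deriv_ne_zero hg'

/-- `ord_0(z²) = 2`. [folklore] -/
private theorem analyticOrderAt_sq_zero : analyticOrderAt (fun z : ℂ ↦ z ^ 2 - 0 ^ 2) 0 = 2 := by
  have hfun : (fun z : ℂ ↦ z ^ 2 - 0 ^ 2) = id ^ 2 := by funext z; simp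
  rw [hfun, analyticOrderAt_pow analyticAt_id, analyticOrderAt_id]
  simp

/-! ### The Hadamard indices through a given zero -/

/-- `ρₖ = ρ ∨ 1 − ρₖ = ρ ↔ bₖ = 1/((ρ−½)² − 9/4)` (both say `(ρₖ − ½)² = (ρ − ½)²`; with Lean's `0⁻¹ = 0` this needs no
side condition). [folklore] -/
private theorem index_iff {k : ℕ} {ρ : ℂ} :
    (xiPairZero b k = ρ ∨ 1 - xiPairZero b k = ρ) ↔ b k = ((ρ - 1 / 2) ^ 2 - 9 / 4)⁻¹ := by
  have hsq : (xiPairZero b k - 1 / 2) ^ 2 = 9 / 4 + (b k)⁻¹ := by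
    rw [xiPairZero, add_sub_cancel_left, Literature.Analysis.Complex.KiKim.cpow_half_sq]
  constructor
  · intro h
    have e : (ρ - 1 / 2) ^ 2 = 9 / 4 + (b k)⁻¹ := by
      rcases h with h | h
      · rw [← h, hsq]
      · rw [← h, ← hsq]; ring
    rw [e, add_sub_cancel_left, inv_inv]
  · intro h
    have e : (ρ - 1 / 2) ^ 2 = (xiPairZero b k - 1 / 2) ^ 2 := by
      rw [hsq, h, inv_inv]; ring
    rcases sq_eq_sq_iff_eq_or_eq_neg.1 e with h' | h'
    · left; linear_combination -h'
    · right; linear_combination -h'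

/-- **Multiplicities in the Hadamard product of `Ξ_χ`.**  Let `b` be a Hadamard sequence of `Ξ_χ` (primitive `χ ≠ 1`) with its
multiplicity field (`#{n : bₙ = a⁻¹} = ord_a G_χ(· + 9/4)` for `a ≠ 0`).  Then for every zero `ρ` of `Ξ_χ`:

  `#{k : bₖ ≠ 0, ρₖ = ρ} + #{k : bₖ ≠ 0, 1 − ρₖ = ρ} = m_χ(ρ) + m_χ̄(ρ)`.

Off the centre the two index sets partition `{k : bₖ = 1/((ρ−½)²−9/4)}`, of size `ord_{(ρ−½)²} G_χ = ord_ρ Ξ_χ`; at the centre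
`ρ = ½` they coincide and `ord_½ Ξ_χ = 2·ord_0 G_χ` (the even function `Ξ_χ(½+z)` has even order at `0`).
[cite: Conway1978, Ch. XI Thm. 3.4] -/
theorem ncard_index_add_ncard_index_eq (hχ : χ.IsPrimitive) (h1 : χ ≠ 1)
    (hmult : ∀ a : ℂ, a ≠ 0 → {n : ℕ | b n = a⁻¹}.ncard = analyticOrderNatAt (fun w ↦ xiPairLift χ (w + 9 / 4)) a)
    {ρ : ℂ} (hρ : xiPair χ ρ = 0) :
    {k : ℕ | b k ≠ 0 ∧ xiPairZero b k = ρ}.ncard + {k : ℕ | b k ≠ 0 ∧ 1 - xiPairZero b k = ρ}.ncard =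
      DirichletDisc.zeroOrder χ ρ + DirichletDisc.zeroOrder χ⁻¹ ρ := by
  obtain ⟨h0, h1'⟩ := re_mem_Ioo_of_xiPair_eq_zero hχ h1 hρ
  set z₁ : ℂ := ρ - 1 / 2 with hz₁
  set a : ℂ := z₁ ^ 2 - 9 / 4 with ha
  -- `a ≠ 0`: otherwise `(ρ − ½)² = 9/4`, i.e. `ρ ∈ {2, −1}`, outside the strip
  have ha0 : a ≠ 0 := by
    intro h
    have hsq : z₁ ^ 2 = (3 / 2 : ℂ) ^ 2 := by
      rw [ha] at h; linear_combination h
    rcases sq_eq_sq_iff_eq_or_eq_neg.1 hsq with e | e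
    · have := congrArg Complex.re e
      rw [hz₁] at this; simp at this; norm_num at this; linarith
    · have := congrArg Complex.re e
      rw [hz₁] at this; simp at this; norm_num at this; linarith
  -- the order `M := ord_{z₁²} G_χ` and the index set `S = {k : bₖ = a⁻¹}`
  have hS : {n : ℕ | b n = a⁻¹}.ncard = analyticOrderNatAt (xiPairLift χ) (z₁ ^ 2) := by
    rw [hmult a ha0, analyticOrderNatAt, analyticOrderNatAt, analyticOrderAt_xiPairLift_shift]
    congr 2
    rw [ha]; ring
  -- `ord_ρ Ξ_χ = M · ord_{z₁}(z² − z₁²)`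
  have hordρ : analyticOrderAt (xiPair χ) ρ =
      analyticOrderAt (xiPairLift χ) (z₁ ^ 2) * analyticOrderAt (fun z : ℂ ↦ z ^ 2 - z₁ ^ 2) z₁ := by
    have e : ρ = 1 / 2 + z₁ := by rw [hz₁]; ring
    rw [e, ← analyticOrderAt_xiPair_half_add χ z₁, analyticOrderAt_half_add_eq_mul hχ h1 z₁]
  have hordρ' := analyticOrderAt_xiPair_eq h1 h0
  -- finiteness of the order of `G_χ` at `z₁²`
  have hGfin : analyticOrderAt (xiPairLift χ) (z₁ ^ 2) ≠ ⊤ := by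
    intro htop
    rw [htop] at hordρ
    have hne : analyticOrderAt (fun z : ℂ ↦ z ^ 2 - z₁ ^ 2) z₁ ≠ 0 := by
      rw [(analyticAt_id.pow 2 |>.sub analyticAt_const).analyticOrderAt_ne_zero]
      simp
    rw [ENat.top_mul hne] at hordρ
    rw [hordρ] at hordρ'
    exact ENat.top_ne_coe _ hordρ'
  obtain ⟨M, hM⟩ := ENat.ne_top_iff_exists.1 hGfin
  have hSM : {n : ℕ | b n = a⁻¹}.ncard = M := by
    rw [hS, analyticOrderNatAt, ← hM]; rfl
  -- membership in the two index sets
  have hmemS : ∀ k, (b k ≠ 0 ∧ (xiPairZero b k = ρ ∨ 1 - xiPairZero b k = ρ)) ↔ b k = a⁻¹ := by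
    intro k
    constructor
    · rintro ⟨hk, h⟩
      exact index_iff.1 h
    · intro h
      have hk : b k ≠ 0 := by rw [h]; exact inv_ne_zero ha0
      exact ⟨hk, index_iff.2 h⟩
  have hfinS : {n : ℕ | b n = a⁻¹}.Finite := by
    by_contra hinf
    have := Set.Infinite.ncard (Set.not_finite.1 hinf)
    rw [hSM] at this
    -- `M = 0` would mean `G_χ(z₁²) ≠ 0`, but `Ξ_χ(ρ) = 0` forces order `> 0`
    have hpos : 0 < analyticOrderAt (xiPair χ) ρ := by
      rw [pos_iff_ne_zero, ((differentiable_xiPair h1).analyticAt ρ).analyticOrderAt_ne_zero]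
      exact hρ
    rw [hordρ, ← hM, this] at hpos
    simp at hpos
  by_cases hc : ρ = 1 / 2
  · -- centre: both index sets equal `S`, and `ord_½ Ξ_χ = 2M`
    have hz0 : z₁ = 0 := by rw [hz₁, hc]; ring
    have hA : {k : ℕ | b k ≠ 0 ∧ xiPairZero b k = ρ} = {n : ℕ | b n = a⁻¹} := by
      ext k
      simp only [Set.mem_setOf_eq]
      constructor
      · rintro ⟨hk, h⟩; exact (hmemS k).1 ⟨hk, Or.inl h⟩
      · intro h
        obtain ⟨hk, h'⟩ := (hmemS k).2 h
        refine ⟨hk, ?_⟩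
        rcases h' with h' | h'
        · exact h'
        · rw [hc] at h' ⊢; linear_combination -h'
    have hB : {k : ℕ | b k ≠ 0 ∧ 1 - xiPairZero b k = ρ} = {n : ℕ | b n = a⁻¹} := by
      ext k
      simp only [Set.mem_setOf_eq]
      constructor
      · rintro ⟨hk, h⟩; exact (hmemS k).1 ⟨hk, Or.inr h⟩
      · intro h
        obtain ⟨hk, h'⟩ := (hmemS k).2 h
        refine ⟨hk, ?_⟩
        rcases h' with h' | h'
        · rw [hc] at h' ⊢; linear_combination -h'
        · exact h'
    rw [hA, hB, hSM]
    have h2 : analyticOrderAt (fun z : ℂ ↦ z ^ 2 - z₁ ^ 2) z₁ = 2 := by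
      rw [hz0]; exact analyticOrderAt_sq_zero
    rw [h2, ← hM] at hordρ
    rw [hordρ] at hordρ'
    have : ((M * 2 : ℕ) : ℕ∞) = ((DirichletDisc.zeroOrder χ ρ + DirichletDisc.zeroOrder χ⁻¹ ρ : ℕ) : ℕ∞) := by
      rw [← hordρ']; push_cast; rfl
    have := ENat.coe_inj.1 this
    omega
  · -- off centre: the index sets are disjoint and partition `S`; `ord_ρ Ξ_χ = M`
    have hz0 : z₁ ≠ 0 := by
      rw [hz₁]; intro h; exact hc (by linear_combination h)
    have hAB : Disjoint {k : ℕ | b k ≠ 0 ∧ xiPairZero b k = ρ} {k : ℕ | b k ≠ 0 ∧ 1 - xiPairZero b k = ρ} := by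
      rw [Set.disjoint_left]
      rintro k ⟨-, hkA⟩ ⟨-, hkB⟩
      apply hc
      linear_combination -(hkA + hkB) / 2
    have hunion : {k : ℕ | b k ≠ 0 ∧ xiPairZero b k = ρ} ∪ {k : ℕ | b k ≠ 0 ∧ 1 - xiPairZero b k = ρ} =
        {n : ℕ | b n = a⁻¹} := by
      ext k
      simp only [Set.mem_union, Set.mem_setOf_eq]
      rw [← hmemS k]
      tauto
    have hfinA : {k : ℕ | b k ≠ 0 ∧ xiPairZero b k = ρ}.Finite :=
      hfinS.subset (by rw [← hunion]; exact Set.subset_union_left)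
    have hfinB : {k : ℕ | b k ≠ 0 ∧ 1 - xiPairZero b k = ρ}.Finite :=
      hfinS.subset (by rw [← hunion]; exact Set.subset_union_right)
    rw [← Set.ncard_union_eq hAB hfinA hfinB, hunion, hSM]
    have h2 : analyticOrderAt (fun z : ℂ ↦ z ^ 2 - z₁ ^ 2) z₁ = 1 := analyticOrderAt_sq_sub_sq_of_ne_zero hz0
    rw [h2, mul_one, ← hM] at hordρ
    rw [hordρ] at hordρ'
    exact_mod_cast hordρ'

end DirichletTheta

end Literature.NumberTheory.LFunctions

end
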